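import Mathlib
import HarnessLib
import Summits.Ventures.LatticeQCDFlow.Scaling.TiltedProtocolMass
import Summits.Ventures.LatticeQCDFlow.Scaling.PathWorkMoments

/-!
# PerfectRelaxationMoments — under PERFECT relaxation every exponential moment of the Jarzynski
# work of the linear protocol is EXACTLY the product of the one-step MGFs:
# `E_F[e^{−t(W−ΔF)}] = exp(Σ_{k<n} Λ_{c_k,δ_k}(t))`, and `ÊSS = exp(−Σ_k Λ_{c_k,δ_k}(2))`

HONEST FRAMING: exact (Metropolis-corrected) sampling algorithms for lattice gauge theory;
figures of merit are autocorrelation/cost numbers at stated couplings and volumes; no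
continuum-physics claim.

Venture `LatticeQCDFlow` (cell pub-lqcd), topic `Scaling`; FANOUT row 19 (`su2-snf`, GEN-10).
OUR WORK (elementary finite sums), nothing cited as a fact.  Vocabulary of
`Scaling/TiltedProtocolMass` (`tTiltLaw`, `tPerfMass`, `tTiltLaw_perfect`,
`log_tPerfMass_add_eq_sum_stepLogMGF`) and `Scaling/PathWorkMoments` (`1/ÊSS = E_F[e^{−2(W−ΔF)}]`).
The PERFECT layer at step `k` resamples from the next Gibbs law, `P_k(x, ·) = π_{c_{k+1}}`
(annealed importance sampling with exact intermediate sampling; the `ρ = 0` case of every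
envelope of this row).  Along ANY grid `c_0, c_1, …`:

* `isStationary_exp_neg_perfect` — the perfect layer leaves `e^{−S_{c_{k+1}}}` invariant;
* **`sum_pathLaw_exp_neg_mul_work_perfect`** — `E_F[e^{−t(W − (F(c_n) − F(c_0)))}] = exp(Σ_{k<n} Λ_{c_k,δ_k}(t))`
  for every real `t`: the perfect part of the `χ²`-route and hypercontractive-route envelopes
  (`Scaling/WorkExponentialMoments` staged, `Scaling/HypercontractiveESSFloor`) is ATTAINED, so
  those envelopes are sharp at `ρ = 0` and their content is exactly the lag factor;
* **`essFrac_path_perfect_eq`** — `ÊSS_perfect = exp(−Σ_{k<n} Λ_{c_k,δ_k}(2))`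
  (`= Π_k Z(c_k+δ_k)²/(Z(c_k)Z(c_k+2δ_k))`, the product of the one-step reweighting ESS fractions of
  `Scaling/LinearFamilyTilt.essFrac_gibbsLaw_linAction`); with `Scaling/LinearFamilyStepMGF(TwoSided)`:
  `exp(−Σ_k δ_k²σ̄²) ≤ ÊSS_perfect ≤ exp(−Σ_k δ_k²σ_min²)` under a variance ceiling / floor
  (`essFrac_path_perfect_ge`, uniform grid: `ÊSS_perfect ≥ e^{−σ̄²/n}`).

NOT CLAIMED: anything about imperfect layers (that is the lag factor of the envelopes).
-/

namespace Summit.Ventures.LatticeQCDFlow.Scaling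

open Finset
open Literature.Probability.MarkovChains (stepLaw IsStationary)
open Summit.Ventures.LatticeQCDFlow.Exactness
open Summit.Ventures.LatticeQCDFlow.Theory2

variable {X : Type*} [Fintype X] [Nonempty X]

/-- The perfect layer `P(x, ·) = π_S` leaves the Boltzmann weight `e^{−S}` invariant. -/
theorem isStationary_exp_neg_perfect (S : X → ℝ) :
    IsStationary (fun x => Real.exp (-S x)) (fun _ y => gibbsLaw S y) := by
  intro y
  rw [← sum_mul]
  unfold gibbsLaw partitionFn
  have hZ : (∑ x, Real.exp (-S x)) ≠ 0 := (sum_pos (fun x _ => Real.exp_pos _) univ_nonempty).ne'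
  field_simp

/-- **PERFECT RELAXATION ATTAINS THE PERFECT PART**: along any grid `c`,
`E_F[e^{−t(W − (F(c_n) − F(c_0)))}] = exp(Σ_{k<n} Λ_{c_k,δ_k}(t))` for the layers
`P_k(x, ·) = π_{c_{k+1}}`. -/
theorem sum_pathLaw_exp_neg_mul_work_perfect (t : ℝ) (S₀ D : X → ℝ) (c : ℕ → ℝ) (n : ℕ) :
    ∑ ω : Fin (n + 1) → X,
        pathLaw (gibbsLaw (linAction S₀ D (c 0)))
            (fun k : Fin n => fun (_ : X) (y : X) => gibbsLaw (linAction S₀ D (c ((k : ℕ) + 1))) y) ω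
          * Real.exp (-(t * (work (fun k : Fin (n + 1) => linAction S₀ D (c k)) ω
              - (linFreeEnergy S₀ D (c n) - linFreeEnergy S₀ D (c 0)))))
      = Real.exp (∑ k ∈ Finset.range n, stepLogMGF S₀ D (c k) (c (k + 1) - c k) t) := by
  set ΔF := linFreeEnergy S₀ D (c n) - linFreeEnergy S₀ D (c 0) with hΔF
  set P : ℕ → X → X → ℝ := fun k _ y => gibbsLaw (linAction S₀ D (c (k + 1))) y with hP
  have hsplit : ∀ ω : Fin (n + 1) → X,
      pathLaw (gibbsLaw (linAction S₀ D (c 0))) (fun k : Fin n => P k) ω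
          * Real.exp (-(t * (work (fun k : Fin (n + 1) => linAction S₀ D (c k)) ω - ΔF)))
        = Real.exp (t * ΔF)
          * (pathLaw (gibbsLaw (linAction S₀ D (c 0))) (fun k : Fin n => P k) ω
            * Real.exp (-(t * work (fun k : Fin (n + 1) => linAction S₀ D (c k)) ω))) := by
    intro ω
    rw [show -(t * (work (fun k : Fin (n + 1) => linAction S₀ D (c k)) ω - ΔF))
        = t * ΔF + -(t * work (fun k : Fin (n + 1) => linAction S₀ D (c k)) ω) by ring,
      Real.exp_add]
    ring
  have hP' : (fun k : Fin n => fun (_ : X) (y : X) => gibbsLaw (linAction S₀ D (c ((k : ℕ) + 1))) y)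
      = fun k : Fin n => P k := by rw [hP]
  rw [hP']
  simp_rw [hsplit]
  rw [← mul_sum, sum_pathLaw_exp_neg_mul_work_eq t S₀ D c P n]
  have hperf : tTiltLaw t S₀ D c P n = fun x => tPerfMass t S₀ D c n * gibbsLaw (linAction S₀ D (c n)) x := by
    rw [hP]; exact tTiltLaw_perfect t S₀ D c n
  rw [hperf]
  simp only
  rw [← mul_sum, sum_gibbsLaw, mul_one, ← log_tPerfMass_add_eq_sum_stepLogMGF t S₀ D c n,
    Real.exp_add, Real.exp_log (tPerfMass_pos t S₀ D c n), hΔF]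
  ring

/-- **THE REWEIGHTING ESS OF PERFECT RELAXATION**: `ÊSS_perfect = exp(−Σ_{k<n} Λ_{c_k,δ_k}(2))`. -/
theorem essFrac_path_perfect_eq (S₀ D : X → ℝ) (c : ℕ → ℝ) (n : ℕ) :
    essFrac (revPathLaw (fun k : Fin (n + 1) => linAction S₀ D (c k))
          (fun k : Fin n => fun (_ : X) (y : X) => gibbsLaw (linAction S₀ D (c ((k : ℕ) + 1))) y))
        (pathLaw (gibbsLaw (linAction S₀ D (c ((0 : Fin (n + 1)) : ℕ))))
          (fun k : Fin n => fun (_ : X) (y : X) => gibbsLaw (linAction S₀ D (c ((k : ℕ) + 1))) y))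
      = Real.exp (-(∑ k ∈ Finset.range n, stepLogMGF S₀ D (c k) (c (k + 1) - c k) 2)) := by
  set S : Fin (n + 1) → X → ℝ := fun k => linAction S₀ D (c k) with hS
  set P : Fin n → X → X → ℝ := fun k _ y => gibbsLaw (linAction S₀ D (c ((k : ℕ) + 1))) y with hP
  have hPpos : ∀ k x y, 0 < P k x y := fun k x y => gibbsLaw_pos _ y
  have hst : ∀ k : Fin n, IsStationary (fun x => Real.exp (-(S k.succ x))) (P k) := by
    intro k
    have h := isStationary_exp_neg_perfect (linAction S₀ D (c ((k : ℕ) + 1)))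
    simpa only [hS, hP, Fin.val_succ] using h
  have hid := inv_essFrac_path_eq_sum_exp_two S hPpos hst
  have hSlast : freeEnergy (S (Fin.last n)) = linFreeEnergy S₀ D (c n) := by
    rw [hS, linFreeEnergy]; simp only [Fin.val_last]
  have hS0 : freeEnergy (S 0) = linFreeEnergy S₀ D (c 0) := by rw [hS, linFreeEnergy]; simp
  have hS0' : gibbsLaw (S 0) = gibbsLaw (linAction S₀ D (c 0)) := by rw [hS]; simp
  rw [hSlast, hS0, hS0'] at hid
  have hperf := sum_pathLaw_exp_neg_mul_work_perfect 2 S₀ D c n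
  have hS0'' : gibbsLaw (linAction S₀ D (c ((0 : Fin (n + 1)) : ℕ))) = gibbsLaw (S 0) := by
    rw [hS]
  rw [hS0'', hS0']
  have hsum : (essFrac (revPathLaw S P) (pathLaw (gibbsLaw (linAction S₀ D (c 0))) P))⁻¹
      = Real.exp (∑ k ∈ Finset.range n, stepLogMGF S₀ D (c k) (c (k + 1) - c k) 2) := by
    rw [hid, ← hperf]
  rw [Real.exp_neg, ← hsum, inv_inv]

/-- **The perfect-relaxation ESS from a variance ceiling (uniform grid)**:
`ÊSS_perfect ≥ exp(−σ̄²/n)` when `Var_c(D) ≤ σ̄²` for all `c`. -/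
theorem essFrac_path_perfect_uniform_ge (S₀ D : X → ℝ) {n : ℕ} (hn : n ≠ 0) {σbar : ℝ}
    (hσ : ∀ c, varD S₀ D c ≤ σbar ^ 2) :
    Real.exp (-(σbar ^ 2 / n))
      ≤ essFrac (revPathLaw (fun k : Fin (n + 1) => linAction S₀ D ((k : ℝ) / n))
          (fun k : Fin n => fun (_ : X) (y : X) => gibbsLaw (linAction S₀ D ((((k : ℕ) + 1 : ℕ) : ℝ) / n)) y))
        (pathLaw (gibbsLaw (linAction S₀ D ((((0 : Fin (n + 1)) : ℕ) : ℝ) / n)))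
          (fun k : Fin n => fun (_ : X) (y : X) =>
            gibbsLaw (linAction S₀ D ((((k : ℕ) + 1 : ℕ) : ℝ) / n)) y)) := by
  have h := essFrac_path_perfect_eq S₀ D (fun k : ℕ => (k : ℝ) / n) n
  simp only at h
  have hsum := sum_stepLogMGF_uniform_le 2 S₀ D hn (σbar := σbar) hσ
  rw [show (2:ℝ) * (2 - 1) = 2 by norm_num, max_eq_left (by norm_num : (0:ℝ) ≤ 2)] at hsum
  rw [h]
  refine Real.exp_le_exp.mpr ?_
  have : ∑ k ∈ Finset.range n, stepLogMGF S₀ D ((k : ℝ) / n) (((k + 1 : ℕ) : ℝ) / n - (k : ℝ) / n) 2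
      ≤ σbar ^ 2 / n := hsum.trans (by ring_nf; rfl)
  linarith

end Summit.Ventures.LatticeQCDFlow.Scaling
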